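import Summits.Ventures.HodgeRepro2.A2PontryaginFullPlane
import Summits.Ventures.HodgeRepro2.A2LefschetzWeilProjection
import Summits.Ventures.HodgeRepro2.A2LefschetzSplitting
import Summits.Ventures.HodgeRepro2.A2PontryaginComm

/-!
# A2PontryaginLeibniz — the Leibniz rule of the Pontryagin product and the counit `z ⋆ 1 = (∫ z)·1`

Tier-4 annex of sub-claim A2 (seat p6, cell pub-hodge-repro2); §8(d): uses an L-value-free
non-vanishing device: NO.

The Pontryagin product `z ⋆ x = m_*(z ⊗ x)` of the twelve-plane model (row 92, `pontryagin`) is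
characterised by `∫_B (z ⋆ x) ∧ u = II(inl z · inr x · Δu)` for all `u`.  Two structural facts
about it that the operator identity of rows 109 / 117 (`z ⋆ θ^k`, `z ⋆ E_T` as contraction
operators) does not contain:

* `pontryagin_mul_gen_add` (THE LEIBNIZ RULE): for `x ∈ ⋀^k` and every `z`,
  `(z ∧ a) ⋆ x + z ⋆ (a ∧ x) = (−1)^k (z ⋆ x) ∧ a` for every generator `a = gen j`; in the
  homogeneous form `gen_mul_pontryagin`: for `z ∈ ⋀^i`,
  `a ∧ (z ⋆ x) = (a ∧ z) ⋆ x + (−1)^i z ⋆ (a ∧ x)` — the cup product with a class of degree one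
  is a (graded) derivation of the Pontryagin product;
* `pontryagin_one_eq` (THE COUNIT): `z ⋆ 1 = (∫_B z) • 1` for every `z` — the Pontryagin product
  with the unit of the cup product is the integral (row 109's `pontryagin_one` expresses the same
  element as `(∏c)·vol/n! • Λ^n z`).

Both are proved from the characterising identity: the coproduct of `a ∧ u` is
`(inl a + inr a) · Δu` (p5's `cop_gen`), and the two graded commutations
`x · a = (−1)^k a · x` in `A` and `inr x · inl a = (−1)^k inl a · inr x` in the graded tensor
square (`mul_gen_of_mem`, `inr_mul_inl_gen_of_mem`).  The counit uses row 117's computation of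
`II(inl z · inr E_T · Δ(plane-sorted monomial))` at `T = ∅`.

What stays prose: that the model's `⋆` is the Pontryagin product `m_*(pr_1^* z ∪ pr_2^* x)` of
the abelian variety `B` (A4.1.0, A4.3.3); nothing here is on the N1 chain.
-/

namespace Summit.Ventures.HodgeRepro2.A2PontryaginLeibniz

open WeilPlanes WeilIntegral WeilCoproduct WeilPairing A2ModelDuality A2PontryaginModel
  A2PlaneMonomials A2CoproductMain

variable {ι : Type*} [DecidableEq ι] [Fintype ι]

omit [Fintype ι] in
/-- Graded commutation with a generator in the model: `x ∧ a = (−1)^k a ∧ x` for `x ∈ ⋀^k`. -/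
theorem mul_gen_of_mem (j : Gen ι) {k : ℕ} {x : A ι} (hx : x ∈ grading ι k) :
    x * gen j = (-1 : ℂ) ^ k • (gen j * x) := by
  refine Submodule.pow_induction_on_left' (LinearMap.range (ExteriorAlgebra.ι ℂ : V ι →ₗ[ℂ] A ι))
    (C := fun n x _ => x * gen j = (-1 : ℂ) ^ n • (gen j * x)) ?_ ?_ ?_ hx
  · intro r
    simp only [pow_zero, one_smul]
    exact Algebra.commutes r (gen j)
  · intro x y n _ _ hx hy
    simp only [add_mul, mul_add, hx, hy, smul_add]
  · rintro m ⟨v, rfl⟩ n x _ hx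
    have h1 : ExteriorAlgebra.ι ℂ v * gen j = -(gen j * ExteriorAlgebra.ι ℂ v) := by
      rw [A2HardLefschetzOps.gen_mul_ι, neg_neg]
    calc ExteriorAlgebra.ι ℂ v * x * gen j
        = ExteriorAlgebra.ι ℂ v * ((-1 : ℂ) ^ n • (gen j * x)) := by rw [mul_assoc, hx]
      _ = (-1 : ℂ) ^ n • (ExteriorAlgebra.ι ℂ v * gen j * x) := by rw [mul_smul_comm, mul_assoc]
      _ = (-1 : ℂ) ^ (n + 1) • (gen j * (ExteriorAlgebra.ι ℂ v * x)) := by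
        rw [h1, neg_mul, smul_neg, pow_succ, mul_neg_one, neg_smul, mul_assoc]

omit [Fintype ι] in
/-- Graded commutation in the graded tensor square: `inr x · inl a = (−1)^k inl a · inr x` for
`x ∈ ⋀^k` and a generator `a` (p5's `inr_ι_mul_inl_ι` iterated). -/
theorem inr_mul_inl_gen_of_mem (j : Gen ι) {k : ℕ} {x : A ι} (hx : x ∈ grading ι k) :
    inr x * inl (gen j) = (-1 : ℂ) ^ k • (inl (gen j) * inr x) := by
  refine Submodule.pow_induction_on_left' (LinearMap.range (ExteriorAlgebra.ι ℂ : V ι →ₗ[ℂ] A ι))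
    (C := fun n x _ => inr x * inl (gen j) = (-1 : ℂ) ^ n • (inl (gen j) * inr x)) ?_ ?_ ?_ hx
  · intro r
    simp only [pow_zero, one_smul, AlgHom.commutes]
    exact Algebra.commutes r (inl (gen j))
  · intro x y n _ _ hx hy
    simp only [map_add, add_mul, mul_add, hx, hy, smul_add]
  · rintro m ⟨v, rfl⟩ n x _ hx
    have h1 : inr (ExteriorAlgebra.ι ℂ v) * inl (gen j) =
        -(inl (gen j) * inr (ExteriorAlgebra.ι ℂ v)) :=
      inr_ι_mul_inl_ι v (Pi.single j 1)
    calc inr (ExteriorAlgebra.ι ℂ v * x) * inl (gen j)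
        = inr (ExteriorAlgebra.ι ℂ v) * (inr x * inl (gen j)) := by
          rw [map_mul inr (ExteriorAlgebra.ι ℂ v) x, mul_assoc]
      _ = (-1 : ℂ) ^ n • (inr (ExteriorAlgebra.ι ℂ v) * inl (gen j) * inr x) := by
          rw [hx, mul_smul_comm, mul_assoc]
      _ = (-1 : ℂ) ^ (n + 1) • (inl (gen j) * inr (ExteriorAlgebra.ι ℂ v * x)) := by
          rw [h1, neg_mul, smul_neg, pow_succ, mul_neg_one, neg_smul, mul_assoc,
            map_mul inr (ExteriorAlgebra.ι ℂ v) x]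

/-- THE LEIBNIZ RULE OF THE PONTRYAGIN PRODUCT (right form): for `x ∈ ⋀^k`, every `z` and every
generator `a = gen j`, `(z ∧ a) ⋆ x + z ⋆ (a ∧ x) = (−1)^k • ((z ⋆ x) ∧ a)`. -/
theorem pontryagin_mul_gen_add (z : A ι) {k : ℕ} {x : A ι} (hx : x ∈ grading ι k) (j : Gen ι) :
    pontryagin (z * gen j) x + pontryagin z (gen j * x) =
      (-1 : ℂ) ^ k • (pontryagin z x * gen j) := by
  have key : ∀ u, integral ((pontryagin (z * gen j) x + pontryagin z (gen j * x)) * u) =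
      integral (((-1 : ℂ) ^ k • (pontryagin z x * gen j)) * u) := by
    intro u
    rw [add_mul, map_add, integral_pontryagin_mul, integral_pontryagin_mul, smul_mul_assoc,
      map_smul, mul_assoc (pontryagin z x), integral_pontryagin_mul z x (gen j * u),
      map_mul cop (gen j) u, cop_gen, add_mul, mul_add, map_add]
    have e1 : inl z * inr x * (inl (gen j) * cop u) =
        (-1 : ℂ) ^ k • (inl (z * gen j) * inr x * cop u) := by
      rw [← mul_assoc, mul_assoc (inl z), inr_mul_inl_gen_of_mem j hx, mul_smul_comm,
        smul_mul_assoc, ← mul_assoc, ← map_mul inl z (gen j)]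
    have e2 : inl z * inr x * (inr (gen j) * cop u) =
        (-1 : ℂ) ^ k • (inl z * inr (gen j * x) * cop u) := by
      rw [← mul_assoc, mul_assoc (inl z), ← map_mul inr x (gen j), mul_gen_of_mem j hx,
        map_smul, mul_smul_comm, smul_mul_assoc]
    have hsq : ((-1 : ℂ) ^ k) * (-1 : ℂ) ^ k = 1 := by
      rw [← pow_add, ← two_mul, pow_mul, neg_one_sq, one_pow]
    rw [e1, e2, map_smul, map_smul, smul_add, smul_smul, smul_smul, hsq, one_smul, one_smul]
  have h0 := eq_zero_of_forall_integral_mul_eq_zero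
    (x := pontryagin (z * gen j) x + pontryagin z (gen j * x) -
      (-1 : ℂ) ^ k • (pontryagin z x * gen j)) (fun u => by rw [sub_mul, map_sub, key, sub_self])
  exact sub_eq_zero.mp h0

/-- The Pontryagin product of classes of total degree `< 2|ι|` vanishes (row 99's degree
bookkeeping read on the row-90 basis). -/
theorem pontryagin_eq_zero_of_lt {i k : ℕ} {z x : A ι} (hz : z ∈ grading ι i)
    (hx : x ∈ grading ι k) (h : i + k < Fintype.card (Gen ι)) : pontryagin z x = 0 := by
  have hP : pontryaginFunctional z x = 0 := by
    refine aBasis.ext fun s => ?_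
    rw [LinearMap.zero_apply]
    refine A2PontryaginDegree.pontryaginFunctional_eq_zero_of_mem hz hx
      (A2PontryaginDegree.aBasis_mem_grading s) ?_
    have hs : s.card ≤ Fintype.card (Gen ι) := by
      simpa using Finset.card_le_univ s
    omega
  show integralDualEquiv.symm (pontryaginFunctional z x) = 0
  rw [hP, map_zero]

/-- THE LEIBNIZ RULE, homogeneous form: for `z ∈ ⋀^i`, `x ∈ ⋀^k` and a generator `a`,
`a ∧ (z ⋆ x) = (a ∧ z) ⋆ x + (−1)^i • (z ⋆ (a ∧ x))` — the cup product with a degree-one class is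
a graded derivation of the Pontryagin product. -/
theorem gen_mul_pontryagin {i k : ℕ} {z x : A ι} (hz : z ∈ grading ι i) (hx : x ∈ grading ι k)
    (j : Gen ι) :
    gen j * pontryagin z x = pontryagin (gen j * z) x + (-1 : ℂ) ^ i • pontryagin z (gen j * x) := by
  have hzg : z * gen j = (-1 : ℂ) ^ i • (gen j * z) := mul_gen_of_mem j hz
  have hL := pontryagin_mul_gen_add z hx j
  rw [hzg, pontryagin_smul_left] at hL
  -- `hL : (−1)^i • (a ∧ z) ⋆ x + z ⋆ (a ∧ x) = (−1)^k • ((z ⋆ x) ∧ a)`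
  have hsq : ((-1 : ℂ) ^ i) * (-1 : ℂ) ^ i = 1 := by
    rw [← pow_add, ← two_mul, pow_mul, neg_one_sq, one_pow]
  -- it suffices to commute `a` past the product: `(z ⋆ x) ∧ a = (−1)^(i+k) • a ∧ (z ⋆ x)`
  suffices hc : pontryagin z x * gen j = (-1 : ℂ) ^ (i + k) • (gen j * pontryagin z x) by
    rw [hc, smul_smul, ← pow_add, show k + (i + k) = i + 2 * k by ring, pow_add, pow_mul,
      neg_one_sq, one_pow, mul_one] at hL
    -- `hL : (−1)^i • (a ∧ z) ⋆ x + z ⋆ (a ∧ x) = (−1)^i • (a ∧ (z ⋆ x))`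
    have := congrArg (fun w => (-1 : ℂ) ^ i • w) hL
    simp only [smul_add, smul_smul, hsq, one_smul] at this
    exact this.symm
  have h0l : ∀ w : A ι, pontryagin (0 : A ι) w = 0 := fun w => by
    have := pontryagin_smul_left (0 : ℂ) (0 : A ι) w
    rwa [zero_smul, zero_smul] at this
  have h0r : ∀ w : A ι, pontryagin w (0 : A ι) = 0 := fun w => by
    have := A2PontryaginFullPlane.pontryagin_smul_right (0 : ℂ) w (0 : A ι)
    rwa [zero_smul, zero_smul] at this
  rcases lt_or_ge (Fintype.card (Gen ι)) i with hi | hi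
  · have : z = 0 := A2LefschetzSplitting.eq_zero_of_mem_grading_of_lt
      (by rwa [A2IntegralDegree.card_gen] at hi) hz
    subst this
    rw [h0l, zero_mul, mul_zero, smul_zero]
  rcases lt_or_ge (Fintype.card (Gen ι)) k with hk | hk
  · have : x = 0 := A2LefschetzSplitting.eq_zero_of_mem_grading_of_lt
      (by rwa [A2IntegralDegree.card_gen] at hk) hx
    subst this
    rw [h0r, zero_mul, mul_zero, smul_zero]
  by_cases hik : Fintype.card (Gen ι) ≤ i + k
  · -- the product is homogeneous of degree `i + k − 2|ι|`, and `2|ι|` is even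
    have hm := A2PontryaginDegree.pontryagin_mem_grading hz hx hi hk hik
    have hsign : (-1 : ℂ) ^ (i + k - Fintype.card (Gen ι)) = (-1 : ℂ) ^ (i + k) := by
      have hN : i + k = (i + k - Fintype.card (Gen ι)) + 2 * Fintype.card ι := by
        rw [← A2IntegralDegree.card_gen]; omega
      conv_rhs => rw [hN]
      rw [pow_add, pow_mul, neg_one_sq, one_pow, mul_one]
    rw [mul_gen_of_mem j hm, hsign]
  · rw [not_le] at hik
    rw [pontryagin_eq_zero_of_lt hz hx hik, zero_mul, mul_zero, smul_zero]

/-! ### The counit `z ⋆ 1 = (∫ z) • 1` -/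

omit [Fintype ι] in
/-- A plane-sorted monomial with every factor `1` is `1`. -/
theorem planeProd_eq_one_of_forall {L : List ι} {m : ι → Bool × Bool}
    (h : ∀ p ∈ L, m p = (false, false)) : planeProd L m = 1 := by
  refine List.prod_eq_one fun x hx => ?_
  rw [List.mem_map] at hx
  obtain ⟨p, hp, rfl⟩ := hx
  rw [h p hp]
  simp [pf, pl, mono]

/-- `∫_B` of a plane-sorted monomial over all planes is `vol` if every plane carries `E_p` and
`0` otherwise. -/
theorem integral_planeProd_univ (m : ι → Bool × Bool) :
    integral (planeProd Finset.univ.toList m) =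
      if Finset.univ ⊆ Eplanes Finset.univ.toList m then vol ι else 0 := by
  split_ifs with hE
  · rw [A2LefschetzWeilProjection.planeProd_eq_ET_mul (Finset.nodup_toList _) (S := Finset.univ)
      (fun p _ => (mem_Eplanes.mp (hE (Finset.mem_univ p)))),
      planeProd_eq_one_of_forall (fun p _ => eraseS_apply_of_mem m (Finset.mem_univ p)), mul_one]
    rfl
  · rw [Finset.not_subset] at hE
    obtain ⟨p, -, hp⟩ := hE
    have hmp : m p ≠ (true, true) := fun h =>
      hp (mem_Eplanes.mpr ⟨Finset.mem_toList.mpr (Finset.mem_univ p), h⟩)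
    obtain ⟨b, hb⟩ := A2LamAdjoint.exists_notMem_pl_of_ne p hmp
    have h0 := A2LamAdjoint.integral_planeProd_mul_planeProd_eq_zero Finset.univ.toList
      (m' := fun _ => (false, false)) hb (A2LamAdjoint.notMem_pl_ff p b)
    rwa [planeProd_eq_one_of_forall (fun _ _ => rfl), mul_one] at h0

/-- `II(inl z · Δ P) = ∫ z · ∫ P` for a plane-sorted monomial `P` over all planes (row 117's
`II_pair_ET_cop_planeProd` at `T = ∅`). -/
theorem II_inl_mul_cop_planeProd (z : A ι) (m : ι → Bool × Bool) :
    II (inl z * cop (planeProd Finset.univ.toList m)) =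
      integral z * integral (planeProd Finset.univ.toList m) := by
  have h := A2PontryaginFullPlane.II_pair_ET_cop_planeProd (Finset.nodup_toList Finset.univ) m z ∅
  rw [WeilPlanes.ET_empty, map_one, mul_one, Finset.sdiff_empty] at h
  rw [h, integral_planeProd_univ]
  split_ifs with hE
  · rw [planeProd_eq_one_of_forall (fun p _ => eraseS_apply_of_mem m (Finset.mem_univ p)), mul_one,
      mul_comm]
  · rw [mul_zero]

/-- `II(inl z · Δ u) = ∫ z · ∫ u` for every `u` (by linearity over the row-90 basis). -/
theorem II_inl_mul_cop (z u : A ι) : II (inl z * cop u) = integral z * integral u := by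
  have h : (II ∘ₗ LinearMap.mulLeft ℂ (inl z) ∘ₗ cop.toLinearMap : A ι →ₗ[ℂ] ℂ) =
      integral z • integral := by
    refine aBasis.ext fun s => ?_
    obtain ⟨ε, -, hε⟩ := A2LamAdjoint.exists_sign_aBasis s
    simp only [LinearMap.comp_apply, LinearMap.mulLeft_apply, AlgHom.toLinearMap_apply,
      LinearMap.smul_apply, smul_eq_mul]
    rw [hε, map_smul, mul_smul_comm, map_smul, smul_eq_mul, II_inl_mul_cop_planeProd, map_smul,
      smul_eq_mul]
    ring
  have := LinearMap.congr_fun h u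
  simpa using this

/-- THE COUNIT: `z ⋆ 1 = (∫_B z) • 1` for every `z` — the Pontryagin product with the unit of the
cup product is the integral. -/
theorem pontryagin_one_eq (z : A ι) : pontryagin z 1 = integral z • 1 := by
  symm
  apply pontryagin_unique
  intro u
  rw [map_one, mul_one, II_inl_mul_cop, smul_mul_assoc, one_mul, map_smul, smul_eq_mul]

/-- `z ⋆ 1 = 0` unless `z` has the top degree `2|ι|`. -/
theorem pontryagin_one_eq_zero_of_mem {i : ℕ} {z : A ι} (hz : z ∈ grading ι i)
    (hi : i ≠ Fintype.card (Gen ι)) : pontryagin z 1 = 0 := by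
  rw [pontryagin_one_eq, A2PontryaginComm.integral_eq_zero_of_mem_of_ne hz hi, zero_smul]

/-- The counit on the top form: `E_univ ⋆ 1 = vol • 1`. -/
theorem pontryagin_ET_univ_one : pontryagin (ET (Finset.univ : Finset ι)) 1 = vol ι • 1 :=
  pontryagin_one_eq _

end Summit.Ventures.HodgeRepro2.A2PontryaginLeibniz
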